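import Mathlib
import Summits.ResolutionOfSingularities.ResolutionOfSingularities.Theorems.WeightedInvariantLocalWeightedDropMonicDescentLabels

/-!
# `WeightedInvariant.LocalWeightedDrop`, stub S3πM `stub_wildPurelyInseparableReductionWon`: the PURE-POWER POLYHEDRON DESCENT —
# labels `y^q + A(u₁,u₂)` read modulo `q`-th powers, cleaning, permissibility, graph curves, and the successor labels of the strategy Σ**_q
# (definitions; piece P-L of the pure-power key)

Crux item stmt-ResolutionOfSingularities-8899 `LocalWeightedDrop` (route `ResolutionOfSingularities/WeightedInvariant`), registered skeleton v29,
stub S3πM `stub_wildPurelyInseparableReductionWon` (purely inseparable surface forms `y^q + A₀(x₁,x₂)`, `q = p^e > 2`).  [OURS · L1 W4.3, chain w43,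
lead prover (gen 3).  Objects the engine line posits for a SECOND KEY to S3πM; the MODEL is Cossart–Jannsen–Saito LNM 2270 Ch. 8/11/13 for
`J = (y^q + A₀)`, `e = 2`, `k = k̄`, exactly as the landed degree-2 key N4″ (`…Theorems.MonicDescent*`, `stub_monicDoublePointDescends` p500522) with
`A₁ := 0` and the scale `2` replaced by `q`; nothing here is a statement of any manuscript.]

WHY THE PURE CASE IS A ONE-SERIES GAME.  In characteristic `p`, for `q = p^e`, a re-centring `y ↦ y + φ(u)` sends `y^q + A` to `y^q + (A + φ^q)`
(`…WildPurePowerClean.won_purePower_recentre_iff`, p483848) and `φ^q` is supported on the lattice `(qℕ)²`; the coefficients of `A` OFF that lattice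
are therefore an invariant of the position, and CLEANING (deleting every monomial on the lattice; over a perfect field this is a re-centring,
`…WildPurePowerClean.exists_clean`) is canonical.  A clean label is automatically well prepared in CJS's sense (a vertex `v` of Hironaka's polygon
`Δ = supp(A)/q` is solvable iff `qv ∈ (qℕ)²`), so the preparation theory of the degree-2 key (T-1′) collapses to `clean`.

* `nset A` — the support of `A` (= `q ·` the generating points of `Δ(y^q + A; u; y)`); `IsClean q A`, `clean q A` (the off-lattice part);
* `IsPosition q A` — `ord A > q` (the germ `y^q + A` has tangent cone `y^q`); `IsPermissibleOne/Two q A` — `u₁^q ∣ A` / `u₂^q ∣ A`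
  (the curve `V(y,u_i)` is permissible);
* `HasGraphCurve q A` — for some `h = h(u₁)` the curve `V(y, u₂ + u₁h)` is permissible for the cleaned sheared label; `graphShear` an `ε`-choice;
* `succ q A` — THE SUCCESSOR LABELS OF Σ**_q (the degree-2 `MonicDescent.succLabels` verbatim with `divOne q`, `divTwo q`, `blowOne q`, `blowTwo q`
  and `clean q` for `prep`): `V(y,u₁)` permissible ↦ `{A/u₁^q}`; else `V(y,u₂)` ↦ `{A/u₂^q}`; else a graph curve ↦ `{clean(shear_h A)/ũ₂^q}`; else the
  point blow-up: `u₁`-chart, `u₂`-chart, and for every `λ ≠ 0` the `u₁`-chart of `clean(shear_λ A)`.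
The invariants are `MonicDescent.deltaL/alphaL/betaL/gammaL/epsL/zetaL (nset A)` (scale `q`); their laws under `psi q`/`phiE q`/shifts are
`…Theorems.WeightedInvariantLocalWeightedDropNewtonSetChartLaws` (p499926).  Only definitions and unfoldings here.
-/

set_option linter.dupNamespace false -- mandated namespace of this single-conjunct summit

noncomputable section

namespace Summit.ResolutionOfSingularities.ResolutionOfSingularities.Theorems

namespace PureDescent

open MvPowerSeries MonicDescent

variable {k : Type} [Field k]

/-! ## Support, cleanness, the clean part -/

/-- The SUPPORT of a plane series, as a point set in `ℕ²` (the scaled generating set of Hironaka's polygon of `y^q + A`). -/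
def nset (A : MvPowerSeries (Fin 2) k) : Set (Fin 2 →₀ ℕ) := {P | coeff P A ≠ 0}

/-- `A` is CLEAN (w.r.t. `q`): no monomial of `A` has both exponents divisible by `q` (no `q`-th-power monomial survives). -/
def IsClean (q : ℕ) (A : MvPowerSeries (Fin 2) k) : Prop :=
  ∀ P : Fin 2 →₀ ℕ, (∀ i, q ∣ P i) → coeff P A = 0

/-- The CLEAN PART of `A`: the monomials of `A` off the lattice `(qℕ)²`. -/
def clean (q : ℕ) (A : MvPowerSeries (Fin 2) k) : MvPowerSeries (Fin 2) k :=
  fun P => if ∀ i, q ∣ P i then 0 else coeff P A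

/-! ## Positions, permissibility, graph curves -/

/-- A POSITION of the pure-power descent: `ord A > q` (the germ `y^q + A` has order `q` and tangent cone `y^q`). -/
def IsPosition (q : ℕ) (A : MvPowerSeries (Fin 2) k) : Prop := ((q : ℕ) : ℕ∞) < A.order

/-- `V(y, u₁)` is PERMISSIBLE: `u₁^q ∣ A` (every exponent has first coordinate `≥ q`). -/
def IsPermissibleOne (q : ℕ) (A : MvPowerSeries (Fin 2) k) : Prop := ∀ P : Fin 2 →₀ ℕ, coeff P A ≠ 0 → q ≤ P 0

/-- `V(y, u₂)` is PERMISSIBLE: `u₂^q ∣ A`. -/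
def IsPermissibleTwo (q : ℕ) (A : MvPowerSeries (Fin 2) k) : Prop := ∀ P : Fin 2 →₀ ℕ, coeff P A ≠ 0 → q ≤ P 1

/-- Some regular near curve is a GRAPH OVER `u₁`: for some `h = h(u₁)` (no `u₂`), `V(y, ũ₂)` with `ũ₂ = u₂ + u₁h` is permissible for the cleaned
sheared label `clean q (A(u₁, u₂ + u₁h))` (case (a″) of Σ**_q; CJS Lemma 13.6's coordinate change). -/
def HasGraphCurve (q : ℕ) (A : MvPowerSeries (Fin 2) k) : Prop :=
  ∃ h : MvPowerSeries (Fin 2) k, (∀ e : Fin 2 →₀ ℕ, e 1 ≠ 0 → coeff e h = 0) ∧ IsPermissibleTwo q (clean q (shear h A))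

/-- An `ε`-chosen graph-curve shear `h(u₁)` (junk if there is none). -/
def graphShear (q : ℕ) (A : MvPowerSeries (Fin 2) k) : MvPowerSeries (Fin 2) k :=
  Classical.epsilon fun h : MvPowerSeries (Fin 2) k =>
    (∀ e : Fin 2 →₀ ℕ, e 1 ≠ 0 → coeff e h = 0) ∧ IsPermissibleTwo q (clean q (shear h A))

open Classical in
/-- THE SUCCESSOR LABELS OF THE STRATEGY Σ**_q at a (clean) label `A`:
(a′) `V(y,u₁)` permissible ↦ `{A/u₁^q}`; else `V(y,u₂)` permissible ↦ `{A/u₂^q}`;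
(a″) else a graph curve ↦ `{clean(shear_h A)/ũ₂^q}`;
(b) else the point blow-up: the `u₁`-chart of `A`, the `u₂`-chart of `A`, and for every `λ ≠ 0` the `u₁`-chart of `clean (shear_λ A)`. -/
def succ (q : ℕ) (A : MvPowerSeries (Fin 2) k) : Set (MvPowerSeries (Fin 2) k) :=
  if IsPermissibleOne q A then {divOne q A}
  else if IsPermissibleTwo q A then {divTwo q A}
  else if HasGraphCurve q A then {divTwo q (clean q (shear (graphShear q A) A))}
  else {blowOne q A, blowTwo q A} ∪ {B | ∃ c : k, c ≠ 0 ∧ B = blowOne q (clean q (shear (C c) A))}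

/-! ## Unfoldings -/

/-- Membership in the support. -/
theorem mem_nset_iff (A : MvPowerSeries (Fin 2) k) (P : Fin 2 →₀ ℕ) : P ∈ nset A ↔ coeff P A ≠ 0 := Iff.rfl

/-- Coefficients of the clean part. -/
theorem coeff_clean (q : ℕ) (A : MvPowerSeries (Fin 2) k) (P : Fin 2 →₀ ℕ) :
    coeff P (clean q A) = if ∀ i, q ∣ P i then 0 else coeff P A := by
  rfl

/-- Coefficients of the clean part on the lattice vanish. -/
theorem coeff_clean_of_dvd (q : ℕ) (A : MvPowerSeries (Fin 2) k) {P : Fin 2 →₀ ℕ} (hP : ∀ i, q ∣ P i) :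
    coeff P (clean q A) = 0 := by
  rw [coeff_clean, if_pos hP]

/-- Coefficients of the clean part off the lattice are those of `A`. -/
theorem coeff_clean_of_not_dvd (q : ℕ) (A : MvPowerSeries (Fin 2) k) {P : Fin 2 →₀ ℕ} (hP : ¬ ∀ i, q ∣ P i) :
    coeff P (clean q A) = coeff P A := by
  rw [coeff_clean, if_neg hP]

/-- The clean part is clean. -/
theorem isClean_clean (q : ℕ) (A : MvPowerSeries (Fin 2) k) : IsClean q (clean q A) :=
  fun _ hP => coeff_clean_of_dvd q A hP

/-- A clean series is its own clean part. -/
theorem clean_eq_self_of_isClean {q : ℕ} {A : MvPowerSeries (Fin 2) k} (h : IsClean q A) : clean q A = A := by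
  ext P
  by_cases hP : ∀ i, q ∣ P i
  · rw [coeff_clean_of_dvd q A hP, h P hP]
  · rw [coeff_clean_of_not_dvd q A hP]

/-- Cleaning is idempotent. -/
theorem clean_clean (q : ℕ) (A : MvPowerSeries (Fin 2) k) : clean q (clean q A) = clean q A :=
  clean_eq_self_of_isClean (isClean_clean q A)

/-- The support of the clean part: the off-lattice points of the support. -/
theorem mem_nset_clean_iff (q : ℕ) (A : MvPowerSeries (Fin 2) k) (P : Fin 2 →₀ ℕ) :
    P ∈ nset (clean q A) ↔ P ∈ nset A ∧ ¬ ∀ i, q ∣ P i := by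
  rw [mem_nset_iff, mem_nset_iff]
  by_cases hP : ∀ i, q ∣ P i
  · rw [coeff_clean_of_dvd q A hP]
    exact ⟨fun h => absurd rfl h, fun h => absurd hP h.2⟩
  · rw [coeff_clean_of_not_dvd q A hP]
    exact ⟨fun h => ⟨h, hP⟩, fun h => h.1⟩

/-- The support of the clean part is contained in the support. -/
theorem nset_clean_subset (q : ℕ) (A : MvPowerSeries (Fin 2) k) : nset (clean q A) ⊆ nset A :=
  fun P hP => ((mem_nset_clean_iff q A P).mp hP).1

/-- Cleaning is additive. -/
theorem clean_add (q : ℕ) (A B : MvPowerSeries (Fin 2) k) : clean q (A + B) = clean q A + clean q B := by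
  ext P
  by_cases hP : ∀ i, q ∣ P i
  · rw [map_add, coeff_clean_of_dvd q _ hP, coeff_clean_of_dvd q _ hP, coeff_clean_of_dvd q _ hP, add_zero]
  · rw [map_add, coeff_clean_of_not_dvd q _ hP, coeff_clean_of_not_dvd q _ hP, coeff_clean_of_not_dvd q _ hP, map_add]

/-- A series supported on the lattice `(qℕ)²` has zero clean part. -/
theorem clean_eq_zero_of_lattice {q : ℕ} {B : MvPowerSeries (Fin 2) k} (hB : ∀ P : Fin 2 →₀ ℕ, (∃ i, ¬ q ∣ P i) → coeff P B = 0) :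
    clean q B = 0 := by
  ext P
  by_cases hP : ∀ i, q ∣ P i
  · rw [coeff_clean_of_dvd q _ hP, map_zero]
  · rw [coeff_clean_of_not_dvd q _ hP, map_zero]
    exact hB P (not_forall.mp hP)

/-- A position has no monomial of total degree `≤ q`: every support point has `P₀ + P₁ ≥ q + 1`. -/
theorem succ_le_sum_of_isPosition {q : ℕ} {A : MvPowerSeries (Fin 2) k} (hA : IsPosition q A) :
    ∀ P ∈ nset A, q + 1 ≤ P 0 + P 1 := by
  intro P hP
  rw [mem_nset_iff] at hP
  by_contra hlt
  push Not at hlt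
  apply hP
  apply coeff_of_lt_order
  unfold IsPosition at hA
  refine lt_of_le_of_lt ?_ hA
  have hdeg : Finsupp.degree P = P 0 + P 1 := by rw [Finsupp.degree_eq_sum]; simp [Fin.sum_univ_two]
  rw [hdeg]
  exact_mod_cast (by omega : P 0 + P 1 ≤ q)

/-- Conversely, if every support point has `P₀ + P₁ ≥ q + 1` then `A` is a position. -/
theorem isPosition_of_succ_le_sum {q : ℕ} {A : MvPowerSeries (Fin 2) k} (hA : ∀ P ∈ nset A, q + 1 ≤ P 0 + P 1) :
    IsPosition q A := by
  unfold IsPosition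
  have hq : ((q : ℕ) : ℕ∞) < ((q + 1 : ℕ) : ℕ∞) := by exact_mod_cast Nat.lt_succ_self q
  refine lt_of_lt_of_le hq (MvPowerSeries.le_order fun P hP => ?_)
  by_contra hne
  have h := hA P hne
  have hdeg : Finsupp.degree P = P 0 + P 1 := by rw [Finsupp.degree_eq_sum]; simp [Fin.sum_univ_two]
  rw [hdeg] at hP
  have hlt : P 0 + P 1 < q + 1 := by exact_mod_cast hP
  omega

/-- Unfolding of `succ` in the first case. -/
theorem succ_of_isPermissibleOne {q : ℕ} {A : MvPowerSeries (Fin 2) k} (h : IsPermissibleOne q A) : succ q A = {divOne q A} := by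
  unfold succ; rw [if_pos h]

/-- Unfolding of `succ` in the second case. -/
theorem succ_of_isPermissibleTwo {q : ℕ} {A : MvPowerSeries (Fin 2) k} (h1 : ¬ IsPermissibleOne q A) (h2 : IsPermissibleTwo q A) :
    succ q A = {divTwo q A} := by
  unfold succ; rw [if_neg h1, if_pos h2]

/-- Unfolding of `succ` in the graph-curve case. -/
theorem succ_of_hasGraphCurve {q : ℕ} {A : MvPowerSeries (Fin 2) k} (h1 : ¬ IsPermissibleOne q A) (h2 : ¬ IsPermissibleTwo q A)
    (h3 : HasGraphCurve q A) : succ q A = {divTwo q (clean q (shear (graphShear q A) A))} := by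
  unfold succ; rw [if_neg h1, if_neg h2, if_pos h3]

/-- Unfolding of `succ` in the point case. -/
theorem succ_of_point {q : ℕ} {A : MvPowerSeries (Fin 2) k} (h1 : ¬ IsPermissibleOne q A) (h2 : ¬ IsPermissibleTwo q A)
    (h3 : ¬ HasGraphCurve q A) :
    succ q A = {blowOne q A, blowTwo q A} ∪ {B | ∃ c : k, c ≠ 0 ∧ B = blowOne q (clean q (shear (C c) A))} := by
  unfold succ; rw [if_neg h1, if_neg h2, if_neg h3]

/-- The `ε`-chosen graph shear has the defining property when a graph curve exists. -/
theorem graphShear_spec {q : ℕ} {A : MvPowerSeries (Fin 2) k} (h : HasGraphCurve q A) :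
    (∀ e : Fin 2 →₀ ℕ, e 1 ≠ 0 → coeff e (graphShear q A) = 0) ∧ IsPermissibleTwo q (clean q (shear (graphShear q A) A)) :=
  Classical.epsilon_spec h

end PureDescent

end Summit.ResolutionOfSingularities.ResolutionOfSingularities.Theorems

end
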